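import Literature.NumberTheory.LFunctions.VinogradovMeanValueFirstClass
import Literature.NumberTheory.LFunctions.FordVinogradovToolkit
import Literature.NumberTheory.LFunctions.VinogradovMeanValueBound
import Literature.NumberTheory.LFunctions.FordLemma67
import Mathlib.Data.Fin.Tuple.Finset
import Mathlib.Algebra.BigOperators.Associated
import HarnessLib

/-!
# Ford's Lemma 3.2 for `d = 0` (the `k³`-primes fundamental lemma) and Lemma 6.5

Topic `Literature/NumberTheory/LFunctions`. Everything in this file is PROVED; the only definition is
the auxiliary Vandermonde-type product `FordVK.vdm`.

K. Ford, *Vinogradov's integral and bounds for the Riemann zeta function*, Proc. LMS 85 (2002):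
Lemma 3.2 (a generalisation of Wooley's "fundamental lemma") bounds the mixed mean value
`K_s(P,Q;Ψ;q)` by the congruence-restricted count `L_s` for a suitable prime `p` out of the `k³`
smallest primes `> M`; Lemma 6.5 is its non-iterative use with `d = 0`, `T = q = 1`, `Ψ_j = z^j`,
`Q = P`, `r = k`, `M = P^{1/k}`: `J_{s+k,k}(P) ≤ 4k³k! p^{2s+(k²-k)/2} P^k J_{s,k}(P/p)` ((6.10)), whence
the iteration `C' = C max[4k³k! η^{k²-Δ}, V^Δ]`, `Δ' = (1-1/k)Δ`, whose first-class constant `4k³k!`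
is far smaller than Lemma 6.6's `(32/k!)(s+k)^{2k}` for large `s` (the late steps of the rows of
Table 6.1).

## Main results (namespace `Literature.NumberTheory.LFunctions.FordVK`, degree `n = m + 2`)

* `exists_prime_digit_injective`, `card_classA_le_sum` — the Vandermonde pigeonhole: if the `n`-blocks
  `u, u'` of a solution are injective and `P^{n(n-1)} ≤ ∏ 𝒫`, some `p ∈ 𝒫` sees both with distinct
  digits, so "class A" is covered by the tree's first classes `VMV.firstClassProd n s p (P₁ p)`
  (Ivić's `J₁'`, whose bound `VMV.firstClassProd_le` is Ford's (3.4)–(3.7));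
* `card_coincidence_eq`, `card_doubled_le` — "class B" (a coincidence `u_j = u_i` in a block): the
  doubled-variable count equals `∫ f₂ f^{m+s} conj(f^{m+2+s})` and is at most
  `K^{1-1/2n} J_s^{1/2n}` by three Hölder steps (`holder_box`) and the doubling invariance
  `∫ |f₂|^{2k} = J_k` (`integral_norm_tp_two_nu_pow`);
* `ford_lemma32_d0_count`, `ford_lemma32_d0` — **Lemma 3.2 (`d = 0`)**: for `n ≥ 2`, `s ≥ 1`,
  `P ≥ 16n⁴` and a nonempty set `𝒫` of primes with `P^{n(n-1)} ≤ ∏ 𝒫` (and `n < p`, `P < pⁿ`),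
  `J_{n+s,n}([1,P]) ≤ 2 ∑_{p∈𝒫} p^{2s} (p(⌊P/p⌋+1))ⁿ n! p^{n(n-1)/2} J_{s,n}([1,⌊P/p⌋+1])`
  (Ford: threshold `P > 4k⁴` with unordered pairs; here ordered pairs, `16n⁴`);
* `ford_lemma65` — **Lemma 6.5** with the prime windows as a hypothesis (`n³` primes in every
  `(x, ηx]`, `x ≥ V`): `J_{n+s,n}([1,P]) ≤ C max(V^Δ, 4n³n! η^{n²-Δ}) P^{2(s+n)-n(n+1)/2+Δ(1-1/n)}`
  for all `P ≥ 1`, from `J_{s,n}([1,P]) ≤ C P^{2s-n(n+1)/2+Δ}`. The windows are supplied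
  unconditionally with `η = 23/20` by `Sylvester.card_primes_window_ge`
  (`ChebyshevSylvesterPrimeWindows.lean`).

## References

* K. Ford, Proc. London Math. Soc. (3) 85 (2002), 565–633; arXiv:1910.08209: Lemma 3.1, Lemma 3.2
  and its proof ((3.3)–(3.7)), Lemma 6.5 and (6.10). [Ford2002]
* A. Ivić, *The Riemann Zeta-Function* (1985), §6.2 (the tree's `VinogradovMeanValue*.lean`:
  first class, Linnik's lemma). [Ivic1985]
-/

noncomputable section

open Finset MeasureTheory Complex
open scoped Real ComplexConjugate

namespace Literature.NumberTheory.LFunctions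
namespace FordVK

open VMV

/-! ### Vandermonde pigeonhole: an injective block is digit-injective modulo one of many primes -/

/-- For an injective `u : Fin n → ℤ` with values in `[1, P]`, the product of the pairwise
differences `∏_{i<j} |u_i − u_j|` is positive and at most `(P-1)^{n(n-1)/2}`; we only need the
cruder `∏_{i} ∏_{j>i} |u_i − u_j| ≤ P^{n(n-1)/2}` in the form: it is `< ∏ Ps` whenever
`P^{n(n-1)} ≤ ∏ Ps`… packaged directly as the pigeonhole below. First, divisibility:
if a prime `p` divides no difference `u_i − u_j` (`i ≠ j`), the digits `u_i mod p` are distinct.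
[cite: Ford2002, proof of Lemma 3.2 ((3.3): some `p ∈ Ps` does not divide `J(z)J(w)`)] -/
theorem digit_injective_of_not_dvd {n p : ℕ} {u : Fin n → ℤ}
    (h : ∀ i j : Fin n, i ≠ j → ¬ ((p : ℤ) ∣ u i - u j)) :
    Function.Injective (fun i => digit p (u i)) := by
  intro i j hij
  by_contra hne
  exact h i j hne ((digit_eq_digit_iff (u i) (u j)).1 hij)

/-- The absolute discriminant-type product `D(u) = ∏_i ∏_{j > i} |u_i − u_j|` (a natural number).
[cite: Ford2002, Lemma 3.1 (the Vandermonde factor of `J_{k-d}(z; Ψ)`)] -/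
def vdm {n : ℕ} (u : Fin n → ℤ) : ℕ := ∏ i : Fin n, ∏ j ∈ univ.filter (fun j => i < j), (u i - u j).natAbs

/-- `D(u) ≠ 0` for injective `u`. [folklore] -/
theorem vdm_ne_zero {n : ℕ} {u : Fin n → ℤ} (hu : Function.Injective u) : vdm u ≠ 0 := by
  unfold vdm
  refine prod_ne_zero_iff.2 fun i _ => prod_ne_zero_iff.2 fun j hj => ?_
  rw [mem_filter] at hj
  rw [Int.natAbs_ne_zero, sub_ne_zero]
  exact fun h => (ne_of_lt hj.2) (hu h)

/-- `D(u) ≤ (P-1)^{n(n-1)/2} ≤ …`; we use: values in `[1,P]` give each factor `≤ P - 1 < P`, hence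
`D(u) < P^{n(n-1)/2}` is not needed exactly — we prove `D(u) ≤ (P-1)^{#pairs}` with
`#pairs = ∑_i #{j > i}` and bound `#pairs ≤ n(n-1)/2` via `2·#pairs ≤ n(n-1)`… Simplest exact
statement: `D(u) ≤ (P - 1) ^ (n * (n - 1) / 2)`. [folklore] -/
theorem vdm_le {n P : ℕ} {u : Fin n → ℤ} (hu : ∀ i, u i ∈ Finset.Icc (1 : ℤ) P) :
    vdm u ≤ (P - 1) ^ (n * (n - 1) / 2) := by
  unfold vdm
  have hfac : ∀ i j : Fin n, (u i - u j).natAbs ≤ P - 1 := by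
    intro i j
    have hi := mem_Icc.1 (hu i)
    have hj := mem_Icc.1 (hu j)
    have hP1 : 1 ≤ P := by
      have : (1 : ℤ) ≤ P := hi.1.trans hi.2
      exact_mod_cast this
    have : ((u i - u j).natAbs : ℤ) ≤ ((P - 1 : ℕ) : ℤ) := by
      rw [Int.natCast_natAbs, Nat.cast_sub hP1, Nat.cast_one]
      exact abs_sub_le_iff.2 ⟨by linarith, by linarith⟩
    exact_mod_cast this
  have hcard : ∀ i : Fin n, (univ.filter (fun j : Fin n => i < j)).card = n - 1 - i := by
    intro i
    have : univ.filter (fun j : Fin n => i < j) = Finset.Ioi i := by ext j; simp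
    rw [this, Fin.card_Ioi]
  calc ∏ i : Fin n, ∏ j ∈ univ.filter (fun j => i < j), (u i - u j).natAbs
      ≤ ∏ i : Fin n, (P - 1) ^ (n - 1 - (i : ℕ)) := by
        refine prod_le_prod' fun i _ => ?_
        rw [← hcard i]
        exact prod_le_pow_card _ _ _ fun j _ => hfac i j
    _ = (P - 1) ^ (∑ i : Fin n, (n - 1 - (i : ℕ))) := by rw [prod_pow_eq_pow_sum]
    _ = (P - 1) ^ (n * (n - 1) / 2) := by
        congr 1
        have h := Finset.sum_range_id_mul_two n
        have e1 : ∑ i : Fin n, (n - 1 - (i : ℕ)) = ∑ i ∈ range n, (n - 1 - i) := by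
          rw [Fin.sum_univ_eq_sum_range (fun i => n - 1 - i)]
        rw [e1, Finset.sum_range_reflect (fun i => i) n, ← Nat.mul_div_cancel (∑ i ∈ range n, i) two_pos, h]

/-- A prime dividing some difference `u_i − u_j` (`i ≠ j`) divides `D(u)`. [folklore] -/
theorem dvd_vdm_of_dvd_sub {n p : ℕ} {u : Fin n → ℤ} {i j : Fin n} (hij : i ≠ j)
    (h : (p : ℤ) ∣ u i - u j) : p ∣ vdm u := by
  unfold vdm
  rcases lt_or_gt_of_ne hij with hlt | hlt
  · refine dvd_trans ?_ (dvd_prod_of_mem _ (mem_univ i))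
    refine dvd_trans ?_ (dvd_prod_of_mem _ (by simp [hlt] : j ∈ univ.filter (fun j => i < j)))
    exact Int.natCast_dvd.1 h
  · refine dvd_trans ?_ (dvd_prod_of_mem _ (mem_univ j))
    refine dvd_trans ?_ (dvd_prod_of_mem _ (by simp [hlt] : i ∈ univ.filter (fun i' => j < i')))
    have h' : (p : ℤ) ∣ u j - u i := by
      have := h.neg_right; rwa [neg_sub] at this
    exact Int.natCast_dvd.1 h'

/-- **Pigeonhole over many primes** (Ford: "`|T ∏(z_i − z_j)(w_i − w_j)| < P^{k²-k} < ∏_{p∈Ps} p`, thus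
for each solution counted by `S₁` there is some `p ∈ Ps` which does not divide `J(z)J(w)`"): if
`u, u' ∈ [1,P]^n` are injective and `P^{n(n-1)} ≤ ∏ Ps` for a nonempty set `Ps` of primes, then modulo
some `p ∈ Ps` both `u` and `u'` have pairwise distinct digits. [cite: Ford2002, proof of Lemma 3.2 ((3.3))] -/
theorem exists_prime_digit_injective {n P : ℕ} {Ps : Finset ℕ} (hPs : ∀ p ∈ Ps, p.Prime)
    (hne : Ps.Nonempty) (hprod : P ^ (n * (n - 1)) ≤ ∏ p ∈ Ps, p)
    {u u' : Fin n → ℤ} (hu : ∀ i, u i ∈ Finset.Icc (1 : ℤ) P) (hu' : ∀ i, u' i ∈ Finset.Icc (1 : ℤ) P)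
    (hinj : Function.Injective u) (hinj' : Function.Injective u') :
    ∃ p ∈ Ps, Function.Injective (fun i => digit p (u i)) ∧ Function.Injective (fun i => digit p (u' i)) := by
  set D : ℕ := vdm u * vdm u' with hD
  have hD0 : D ≠ 0 := mul_ne_zero (vdm_ne_zero hinj) (vdm_ne_zero hinj')
  -- size: `D ≤ (P-1)^{n(n-1)} < ∏ Ps`
  have hDlt : D < ∏ p ∈ Ps, p := by
    have h1 := vdm_le hu
    have h2 := vdm_le hu'
    have hD1 : D ≤ (P - 1) ^ (n * (n - 1)) := by
      have e : n * (n - 1) / 2 + n * (n - 1) / 2 = n * (n - 1) := by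
        have := Nat.two_mul_div_two_of_even (Nat.even_mul_pred_self n); omega
      calc D ≤ (P - 1) ^ (n * (n - 1) / 2) * (P - 1) ^ (n * (n - 1) / 2) := Nat.mul_le_mul h1 h2
        _ = (P - 1) ^ (n * (n - 1)) := by rw [← pow_add, e]
    rcases Nat.eq_zero_or_pos (n * (n - 1)) with h0 | hpos
    · -- no pairs: `D = 1 < ∏ Ps`
      rw [h0, pow_zero] at hD1
      have h2le : ∀ p ∈ Ps, 2 ≤ p := fun p hp => (hPs p hp).two_le
      obtain ⟨q, hq⟩ := hne
      have : 2 ≤ ∏ p ∈ Ps, p := by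
        calc 2 ≤ q := h2le q hq
          _ = ∏ p ∈ {q}, p := by simp
          _ ≤ ∏ p ∈ Ps, p := prod_le_prod_of_subset_of_one_le' (by simpa using hq)
              (fun p hp _ => le_trans (by norm_num) (h2le p hp))
      omega
    · have hP1 : 1 ≤ P := by
        rcases n with _ | n
        · simp at hpos
        · have := mem_Icc.1 (hu 0); have : (1 : ℤ) ≤ P := this.1.trans this.2; exact_mod_cast this
      have : (P - 1) ^ (n * (n - 1)) < P ^ (n * (n - 1)) :=
        Nat.pow_lt_pow_left (by omega) (by omega)
      omega
  -- pigeonhole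
  by_contra hall
  push Not at hall
  have hdvd : ∀ p ∈ Ps, p ∣ D := by
    intro p hp
    have hp' := hall p hp
    by_cases h1 : Function.Injective (fun i => digit p (u i))
    · have h2 := hp' h1
      obtain ⟨i, j, hij, hne'⟩ := Function.not_injective_iff.1 h2
      exact dvd_mul_of_dvd_right (dvd_vdm_of_dvd_sub hne' ((digit_eq_digit_iff _ _).1 hij)) _
    · obtain ⟨i, j, hij, hne'⟩ := Function.not_injective_iff.1 h1
      exact dvd_mul_of_dvd_left (dvd_vdm_of_dvd_sub hne' ((digit_eq_digit_iff _ _).1 hij)) _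
  have hprimes : ∀ p ∈ Ps, Prime p := fun p hp => (hPs p hp).prime
  have := Nat.le_of_dvd (Nat.pos_of_ne_zero hD0) (Finset.prod_primes_dvd D hprimes hdvd)
  omega

/-- **Class A is covered by the first classes of the primes in `Ps`**: the solutions
`((u,z),(u',z')) ∈ ([1,P]^n × [1,P]^s)²` of `s(u)+s(z) = s(u')+s(z')` with `u` and `u'` injective
number at most `∑_{p ∈ Ps} J₁'(p)` (`VMV.firstClassProd`, the solutions in `[1, pP₁(p)]` whose `n`-blocks
have distinct digits mod `p`), provided `P^{n(n-1)} ≤ ∏ Ps` and `P ≤ p P₁(p)`.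
[cite: Ford2002, proof of Lemma 3.2 ((3.3): `K ≤ 2k³ max_p S₃(p)`)] -/
theorem card_classA_le_sum {n s P : ℕ} {Ps : Finset ℕ} (hPs : ∀ p ∈ Ps, p.Prime)
    (hne : Ps.Nonempty) (hprod : P ^ (n * (n - 1)) ≤ ∏ p ∈ Ps, p) {P₁ : ℕ → ℕ}
    (hP₁ : ∀ p ∈ Ps, P ≤ p * P₁ p) :
    (((tuples n (Finset.Icc (1 : ℤ) P) ×ˢ tuples s (Finset.Icc (1 : ℤ) P)) ×ˢ
        (tuples n (Finset.Icc (1 : ℤ) P) ×ˢ tuples s (Finset.Icc (1 : ℤ) P))).filter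
        (fun w => psv n w.1.1 + psv n w.1.2 = psv n w.2.1 + psv n w.2.2 ∧
          Function.Injective w.1.1 ∧ Function.Injective w.2.1)).card
      ≤ ∑ p ∈ Ps, firstClassProd n s p (P₁ p) := by
  classical
  set I := Finset.Icc (1 : ℤ) P with hI
  set A := (((tuples n I ×ˢ tuples s I) ×ˢ (tuples n I ×ˢ tuples s I)).filter
        (fun w => psv n w.1.1 + psv n w.1.2 = psv n w.2.1 + psv n w.2.2 ∧
          Function.Injective w.1.1 ∧ Function.Injective w.2.1)) with hA
  let good : ℕ → ((Fin n → ℤ) × (Fin s → ℤ)) × ((Fin n → ℤ) × (Fin s → ℤ)) → Prop :=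
    fun p w => Function.Injective (fun i => digit p (w.1.1 i)) ∧
      Function.Injective (fun i => digit p (w.2.1 i))
  have hcover : A ⊆ Ps.biUnion (fun p => A.filter (good p)) := by
    intro w hw
    rw [mem_biUnion]
    have hw' := (mem_filter.1 hw)
    have hmem := hw'.1
    simp only [mem_product, mem_tuples] at hmem
    obtain ⟨p, hp, h1, h2⟩ := exists_prime_digit_injective hPs hne hprod hmem.1.1 hmem.2.1
      hw'.2.2.1 hw'.2.2.2
    exact ⟨p, hp, mem_filter.2 ⟨hw, h1, h2⟩⟩
  have hsub : ∀ p ∈ Ps, (A.filter (good p)).card ≤ firstClassProd n s p (P₁ p) := by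
    intro p hp
    unfold firstClassProd
    refine card_le_card fun w hw => ?_
    rw [mem_filter] at hw
    have hwA := mem_filter.1 hw.1
    have hmem := hwA.1
    simp only [mem_product, mem_tuples] at hmem
    have hIQ : ∀ x ∈ I, x ∈ IQ p (P₁ p) := by
      intro x hx
      rw [hI, mem_Icc] at hx
      unfold IQ; rw [mem_Icc]
      exact ⟨hx.1, hx.2.trans (by exact_mod_cast hP₁ p hp)⟩
    rw [mem_filter, mem_product, mem_product, mem_product]
    refine ⟨⟨⟨?_, ?_⟩, ?_, ?_⟩, hwA.2.1⟩
    · unfold Dinj; rw [mem_filter, mem_tuples]; exact ⟨fun i => hIQ _ (hmem.1.1 i), hw.2.1⟩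
    · rw [mem_tuples]; exact fun i => hIQ _ (hmem.1.2 i)
    · unfold Dinj; rw [mem_filter, mem_tuples]; exact ⟨fun i => hIQ _ (hmem.2.1 i), hw.2.2⟩
    · rw [mem_tuples]; exact fun i => hIQ _ (hmem.2.2 i)
  calc A.card ≤ (Ps.biUnion (fun p => A.filter (good p))).card := card_le_card hcover
    _ ≤ ∑ p ∈ Ps, (A.filter (good p)).card := card_biUnion_le
    _ ≤ ∑ p ∈ Ps, firstClassProd n s p (P₁ p) := sum_le_sum hsub

/-! ### Class B: a coincidence `u_j = u_i` inside the `n`-block (the doubled variable) -/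

/-- `s(insertNth_j(x, v)) = ν(x) + s(v)`. [folklore] -/
theorem psv_insertNth {n m : ℕ} (j : Fin (m + 1)) (x : ℤ) (v : Fin m → ℤ) :
    psv n (Fin.insertNth j x v : Fin (m + 1) → ℤ) = nu n x + psv n v := by
  funext l
  simp only [psv, nu, Pi.add_apply]
  rw [Fin.sum_univ_succAbove _ j, Fin.insertNth_apply_same]
  congr 1
  refine Finset.sum_congr rfl fun i _ => ?_
  rw [Fin.insertNth_apply_succAbove]

/-- **The doubled-variable count.** For `j : Fin (m+2)` and `i' : Fin (m+1)` (the coordinate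
`i = j.succAbove i' ≠ j`), the solutions `((u,z),(u',z')) ∈ (I^{m+2} × I^s)²` of
`s(u) + s(z) = s(u') + s(z')` with `u_j = u_i` are in bijection with the solutions
`(((y,w),z),(u',z')) ∈ ((I × I^m) × I^s) × (I^{m+2} × I^s)` of `2ν(y) + s(w) + s(z) = s(u') + s(z')`.
[cite: Ford2002, proof of Lemma 3.2 (the case `S₂ ≥ S₁`: `∫ |F^{2k-2} F(2α) f^{2s}|`)] -/
theorem card_coincidence_eq {n m s : ℕ} (I : Finset ℤ) (j : Fin (m + 2)) (i' : Fin (m + 1)) :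
    (((tuples (m + 2) I ×ˢ tuples s I) ×ˢ (tuples (m + 2) I ×ˢ tuples s I)).filter
        (fun w => psv n w.1.1 + psv n w.1.2 = psv n w.2.1 + psv n w.2.2 ∧
          w.1.1 j = w.1.1 (j.succAbove i'))).card
      = ((((I ×ˢ tuples m I) ×ˢ tuples s I) ×ˢ (tuples (m + 2) I ×ˢ tuples s I)).filter
        (fun w => 2 • nu n w.1.1.1 + psv n w.1.1.2 + psv n w.1.2 = psv n w.2.1 + psv n w.2.2)).card := by
  classical
  symm
  refine card_nbij'
    (fun (w : ((ℤ × (Fin m → ℤ)) × (Fin s → ℤ)) × ((Fin (m + 2) → ℤ) × (Fin s → ℤ))) =>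
      ((Fin.insertNth j w.1.1.1 (Fin.insertNth i' w.1.1.1 w.1.1.2), w.1.2), w.2))
    (fun (w : ((Fin (m + 2) → ℤ) × (Fin s → ℤ)) × ((Fin (m + 2) → ℤ) × (Fin s → ℤ))) =>
      (((w.1.1 (j.succAbove i'), Fin.removeNth i' (Fin.removeNth j w.1.1)), w.1.2), w.2)) ?_ ?_ ?_ ?_
  · intro w hw
    rw [mem_coe, mem_filter] at hw ⊢
    simp only [mem_product, mem_tuples] at hw ⊢
    obtain ⟨⟨⟨⟨hy, hw'⟩, hz⟩, hu', hz'⟩, heq⟩ := hw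
    refine ⟨⟨⟨?_, hz⟩, hu', hz'⟩, ?_, ?_⟩
    · intro l
      refine Fin.succAboveCases j ?_ (fun l' => ?_) l
      · rw [Fin.insertNth_apply_same]; exact hy
      · rw [Fin.insertNth_apply_succAbove]
        refine Fin.succAboveCases i' ?_ (fun l'' => ?_) l'
        · rw [Fin.insertNth_apply_same]; exact hy
        · rw [Fin.insertNth_apply_succAbove]; exact hw' l''
    · rw [psv_insertNth, psv_insertNth, ← heq, two_smul]; abel
    · rw [Fin.insertNth_apply_same, Fin.insertNth_apply_succAbove, Fin.insertNth_apply_same]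
  · intro w hw
    rw [mem_coe, mem_filter] at hw ⊢
    simp only [mem_product, mem_tuples] at hw ⊢
    obtain ⟨⟨⟨hu, hz⟩, hu', hz'⟩, heq, hcoin⟩ := hw
    refine ⟨⟨⟨⟨hu _, fun l => hu _⟩, hz⟩, hu', hz'⟩, ?_⟩
    -- the equation: `s(u) = ν(u_j) + ν(u_i) + s(rest)`
    have key : psv n w.1.1 = nu n (w.1.1 j) + (nu n (w.1.1 (j.succAbove i')) +
        psv n (Fin.removeNth i' (Fin.removeNth j w.1.1))) := by
      conv_lhs => rw [← Fin.insertNth_self_removeNth j w.1.1]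
      rw [psv_insertNth]
      congr 1
      conv_lhs => rw [← Fin.insertNth_self_removeNth i' (Fin.removeNth j w.1.1)]
      rw [psv_insertNth]
      rfl
    rw [two_smul, ← heq, key, hcoin]; abel
  · intro w _
    simp only [Fin.removeNth_insertNth, Fin.insertNth_apply_succAbove, Fin.insertNth_apply_same]
  · intro w hw
    rw [mem_coe, mem_filter] at hw
    obtain ⟨-, -, hcoin⟩ := hw
    have h1 : Fin.insertNth i' (w.1.1 (j.succAbove i')) (Fin.removeNth i' (Fin.removeNth j w.1.1))
        = Fin.removeNth j w.1.1 := by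
      conv_rhs => rw [← Fin.insertNth_self_removeNth i' (Fin.removeNth j w.1.1)]
      rfl
    have h2 : Fin.insertNth j (w.1.1 (j.succAbove i')) (Fin.removeNth j w.1.1) = w.1.1 := by
      rw [← hcoin, Fin.insertNth_self_removeNth]
    simp only [h1, h2]

/-! ### Hölder on the box `[0,1]^n` for continuous nonnegative functions -/

/-- Hölder's inequality on `[0,1]^n` for continuous nonnegative functions and conjugate exponents.
[folklore] -/
theorem holder_box {n : ℕ} {F G : (Fin n → ℝ) → ℝ} (hF : Continuous F) (hG : Continuous G)
    (hF0 : ∀ α, 0 ≤ F α) (hG0 : ∀ α, 0 ≤ G α) {p q : ℝ} (hpq : p.HolderConjugate q) :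
    ∫ α in box n, F α * G α
      ≤ (∫ α in box n, F α ^ p) ^ (1 / p) * (∫ α in box n, G α ^ q) ^ (1 / q) := by
  haveI : Fact (volume (box n) < ⊤) := ⟨(isCompact_box n).measure_lt_top⟩
  have hmem : ∀ {H : (Fin n → ℝ) → ℝ} (hH : Continuous H) (r : ENNReal),
      MemLp H r (volume.restrict (box n)) := by
    intro H hH r
    obtain ⟨C, hC⟩ := (isCompact_box n).exists_bound_of_continuousOn hH.continuousOn
    refine MemLp.of_bound hH.aestronglyMeasurable C ?_
    rw [ae_restrict_iff' (measurableSet_box n)]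
    exact ae_of_all _ fun α hα => hC α hα
  exact integral_mul_le_Lp_mul_Lq_of_nonneg hpq (ae_of_all _ hF0) (ae_of_all _ hG0)
    (hmem hF _) (hmem hG _)

/-! ### The doubled trigonometric polynomial `f₂(α) = ∑_x e(α·2ν(x))` -/

/-- `∑_{X ∈ I^k} e(α · 2s(X)) = f₂(α)^k`. [folklore] -/
theorem tp_tuples_two_psv (n k : ℕ) (I : Finset ℤ) (α : Fin n → ℝ) :
    tp (tuples k I) (fun X => 2 • psv n X) α = (tp I (fun x => 2 • nu n x) α) ^ k := by
  have h := prod_tp_eq (n := n) (m := k) (fun _ => I) (fun _ => fun x => 2 • nu n x) α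
  rw [prod_const, card_univ, Fintype.card_fin] at h
  rw [h]
  unfold tuples
  congr 1
  funext X
  rw [psv_eq_sum_nu, Finset.smul_sum]

/-- **Doubling does not change the count**: `∫ |f₂|^{2k} = J_{k,n}(I)` (the solutions of
`2 s(X) = 2 s(Y)` are those of `s(X) = s(Y)`). [cite: Ford2002, proof of Lemma 3.2 (`2Ψ` is also of
type `(d,T)`)] -/
theorem integral_norm_tp_two_nu_pow (n k : ℕ) (I : Finset ℤ) :
    ∫ α in box n, ‖tp I (fun x => 2 • nu n x) α‖ ^ (2 * k) = (J n k I : ℝ) := by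
  rw [show (fun α => ‖tp I (fun x => 2 • nu n x) α‖ ^ (2 * k))
      = fun α => ‖(tp I (fun x => 2 • nu n x) α) ^ k‖ ^ 2 by
    funext α; rw [norm_pow, ← pow_mul, mul_comm]]
  simp_rw [← tp_tuples_two_psv]
  rw [integral_norm_sq_tp]
  unfold J Jc
  congr 2
  refine Finset.filter_congr fun XY _ => ?_
  rw [add_zero]
  constructor
  · intro h
    exact smul_right_injective (Fin n → ℤ) (by norm_num : (2 : ℕ) ≠ 0) h
  · intro h; rw [h]

/-! ### The Hölder bound for the doubled count -/

/-- **Ford's Hölder step for `S₂`**: the number of solutions of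
`2ν(y) + s(w) + s(z) = s(u') + s(z')` (`(y,w,z) ∈ I × I^m × I^s`, `(u',z') ∈ I^{m+2} × I^s`) is at
most `K^{1-1/(2a)} J_{s,n}(I)^{1/(2a)}`, `a = m+2`, `K = J_{a+s,n}(I)`:
`∫ |f₂| |f|^{2a+2s-2} ≤ (∫|f|^{2a+2s})^{1-1/a} (∫|f|^{2s})^{1/2a} (∫|f₂|^{2a}|f|^{2s})^{1/2a}` and
`∫|f₂|^{2a}|f|^{2s} ≤ (∫|f₂|^{2a+2s})^{a/(a+s)} (∫|f|^{2a+2s})^{s/(a+s)} = K` (doubling invariance).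
[cite: Ford2002, proof of Lemma 3.2 (the display bounding `K ≤ 2S₂`)] -/
theorem card_doubled_le {n m s : ℕ} (hs : 1 ≤ s) (I : Finset ℤ) :
    (((((I ×ˢ tuples m I) ×ˢ tuples s I) ×ˢ (tuples (m + 2) I ×ˢ tuples s I)).filter
        (fun w => 2 • nu n w.1.1.1 + psv n w.1.1.2 + psv n w.1.2 = psv n w.2.1 + psv n w.2.2)).card : ℝ)
      ≤ (J n (m + 2 + s) I : ℝ) ^ (1 - 1 / (2 * ((m : ℝ) + 2)))
          * (J n s I : ℝ) ^ (1 / (2 * ((m : ℝ) + 2))) := by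
  classical
  -- notation
  set A : ℝ := (m : ℝ) + 2 with hA
  have hA2 : 2 ≤ A := by rw [hA]; have := (Nat.cast_nonneg m : (0 : ℝ) ≤ m); linarith
  have hA0 : 0 < A := by linarith
  have hS1 : (1 : ℝ) ≤ s := by exact_mod_cast hs
  set K : ℝ := (J n (m + 2 + s) I : ℝ) with hK
  set Js : ℝ := (J n s I : ℝ) with hJs
  have hK0 : 0 ≤ K := Nat.cast_nonneg _
  have hJs0 : 0 ≤ Js := Nat.cast_nonneg _
  set g : (Fin n → ℝ) → ℝ := fun α => ‖tp I (nu n) α‖ with hg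
  set h : (Fin n → ℝ) → ℝ := fun α => ‖tp I (fun x => 2 • nu n x) α‖ with hh
  have hg0 : ∀ α, 0 ≤ g α := fun α => norm_nonneg _
  have hh0 : ∀ α, 0 ≤ h α := fun α => norm_nonneg _
  have hgc : Continuous g := (continuous_tp _ _).norm
  have hhc : Continuous h := (continuous_tp _ _).norm
  -- the integrals we know
  have iK : ∫ α in box n, g α ^ (2 * (m + 2 + s)) = K := integral_norm_tp_nu_pow n (m + 2 + s) I
  have iK2 : ∫ α in box n, h α ^ (2 * (m + 2 + s)) = K := integral_norm_tp_two_nu_pow n (m + 2 + s) I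
  have iJs : ∫ α in box n, g α ^ (2 * s) = Js := integral_norm_tp_nu_pow n s I
  -- Step 0: the count as an integral, `N' ≤ ∫ h g^{2m+2s+2}`
  set L := (I ×ˢ tuples m I) ×ˢ tuples s I with hL
  set R := tuples (m + 2) I ×ˢ tuples s I with hR
  set vL : (ℤ × (Fin m → ℤ)) × (Fin s → ℤ) → Fin n → ℤ :=
    fun w => 2 • nu n w.1.1 + psv n w.1.2 + psv n w.2 with hvL
  set vR : (Fin (m + 2) → ℤ) × (Fin s → ℤ) → Fin n → ℤ := fun w => psv n w.1 + psv n w.2 with hvR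
  have hcount := integral_tp_mul_conj_tp (n := n) L R vL vR
  have htpL : ∀ α, tp L vL α = tp I (fun x => 2 • nu n x) α * (tp I (nu n) α) ^ m * (tp I (nu n) α) ^ s := by
    intro α
    rw [hL, ← tp_tuples_psv n m, ← tp_tuples_psv n s, tp_mul, tp_mul]
  have htpR : ∀ α, tp R vR α = (tp I (nu n) α) ^ (m + 2) * (tp I (nu n) α) ^ s := by
    intro α
    rw [hR, ← tp_tuples_psv n (m + 2), ← tp_tuples_psv n s, tp_mul]
  have hnorm : ∀ α, ‖tp L vL α * conj (tp R vR α)‖ = h α * g α ^ (2 * m + 2 * s + 2) := by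
    intro α
    rw [norm_mul, Complex.norm_conj, htpL, htpR]
    simp only [norm_mul, norm_pow]
    rw [hh, hg]; ring
  have step0 : ((((L ×ˢ R).filter (fun ii' => vL ii'.1 = vR ii'.2)).card : ℕ) : ℝ)
      ≤ ∫ α in box n, h α * g α ^ (2 * m + 2 * s + 2) := by
    have h1 := congrArg norm hcount
    rw [Complex.norm_natCast] at h1
    rw [← h1]
    refine (norm_integral_le_integral_norm _).trans (le_of_eq ?_)
    exact integral_congr_ae (ae_of_all _ fun α => hnorm α)
  -- Step 1: Hölder with exponents `A/(A-1)`, `A`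
  set θ₁ : ℝ := (A - 1) / A with hθ₁
  have hθ₁0 : 0 < θ₁ := by rw [hθ₁]; exact div_pos (by linarith) hA0
  have hθ₁1 : 0 < 1 - θ₁ := by rw [hθ₁, sub_div' (by positivity), div_pos_iff]; left; constructor <;> nlinarith
  have h1θ₁ : 1 - θ₁ = 1 / A := by rw [hθ₁]; field_simp; ring
  have hpq₁ := Real.holderConjugate_one_div hθ₁0 hθ₁1 (by ring)
  set F₁ : (Fin n → ℝ) → ℝ := fun α => g α ^ ((2 * A + 2 * s) * θ₁) with hF₁
  set G₁ : (Fin n → ℝ) → ℝ := fun α => h α * g α ^ ((2 * (s : ℝ)) * (1 - θ₁)) with hG₁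
  have hF₁0 : ∀ α, 0 ≤ F₁ α := fun α => Real.rpow_nonneg (hg0 α) _
  have hG₁0 : ∀ α, 0 ≤ G₁ α := fun α => mul_nonneg (hh0 α) (Real.rpow_nonneg (hg0 α) _)
  have hF₁c : Continuous F₁ := hgc.rpow_const fun _ => Or.inr (by positivity)
  have hG₁c : Continuous G₁ := hhc.mul (hgc.rpow_const fun _ => Or.inr (by positivity))
  have H1 := holder_box hF₁c hG₁c hF₁0 hG₁0 hpq₁
  -- identify: `F₁ G₁ = h g^{2m+2s+2}`, `F₁^{1/θ₁} = g^{2(m+2+s)}`, `G₁^{A} = h^{A} g^{2s}`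
  have e_prod : ∀ α, F₁ α * G₁ α = h α * g α ^ (2 * m + 2 * s + 2) := by
    intro α
    rw [hF₁, hG₁]; simp only
    rw [mul_left_comm, ← Real.rpow_add_of_nonneg (hg0 α) (by positivity) (by positivity),
      show (2 * A + 2 * s) * θ₁ + 2 * (s : ℝ) * (1 - θ₁) = ((2 * m + 2 * s + 2 : ℕ) : ℝ) by
        rw [hθ₁, hA]; push_cast; field_simp; try ring, Real.rpow_natCast]
  have e_F : ∀ α, F₁ α ^ (1 / θ₁) = g α ^ (2 * (m + 2 + s)) := by
    intro α
    rw [hF₁]; simp only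
    rw [← Real.rpow_mul (hg0 α), show (2 * A + 2 * s) * θ₁ * (1 / θ₁) = ((2 * (m + 2 + s) : ℕ) : ℝ) by
      rw [hA]; push_cast; field_simp, Real.rpow_natCast]
  have e_G : ∀ α, G₁ α ^ (1 / (1 - θ₁)) = h α ^ (m + 2) * g α ^ (2 * s) := by
    intro α
    rw [hG₁]; simp only
    rw [Real.mul_rpow (hh0 α) (Real.rpow_nonneg (hg0 α) _), ← Real.rpow_mul (hg0 α), h1θ₁,
      one_div_one_div, show 2 * (s : ℝ) * (1 / A) * A = ((2 * s : ℕ) : ℝ) by push_cast; field_simp,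
      Real.rpow_natCast, show A = ((m + 2 : ℕ) : ℝ) by rw [hA]; push_cast; ring, Real.rpow_natCast]
  simp_rw [e_prod, e_F, e_G] at H1
  rw [iK, h1θ₁] at H1
  simp only [one_div_one_div] at H1
  -- Step 2: Cauchy–Schwarz on `∫ h^{m+2} g^{2s}`
  have hpq₂ := Real.holderConjugate_one_div (a := (1 : ℝ) / 2) (b := 1 / 2) (by norm_num) (by norm_num)
    (by norm_num)
  set F₂ : (Fin n → ℝ) → ℝ := fun α => g α ^ s with hF₂
  set G₂ : (Fin n → ℝ) → ℝ := fun α => h α ^ (m + 2) * g α ^ s with hG₂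
  have hF₂0 : ∀ α, 0 ≤ F₂ α := fun α => pow_nonneg (hg0 α) _
  have hG₂0 : ∀ α, 0 ≤ G₂ α := fun α => mul_nonneg (pow_nonneg (hh0 α) _) (pow_nonneg (hg0 α) _)
  have hF₂c : Continuous F₂ := hgc.pow s
  have hG₂c : Continuous G₂ := (hhc.pow _).mul (hgc.pow s)
  have H2 := holder_box hF₂c hG₂c hF₂0 hG₂0 hpq₂
  have e2_prod : ∀ α, F₂ α * G₂ α = h α ^ (m + 2) * g α ^ (2 * s) := by
    intro α; rw [hF₂, hG₂]; simp only; ring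
  have e2_F : ∀ α, F₂ α ^ (1 / (1 / 2 : ℝ)) = g α ^ (2 * s) := by
    intro α; rw [hF₂]; simp only
    rw [one_div_one_div, Real.rpow_two, ← pow_mul, mul_comm]
  have e2_G : ∀ α, G₂ α ^ (1 / (1 / 2 : ℝ)) = h α ^ (2 * (m + 2)) * g α ^ (2 * s) := by
    intro α; rw [hG₂]; simp only
    rw [one_div_one_div, Real.rpow_two]; ring
  simp_rw [e2_prod, e2_F, e2_G] at H2
  rw [iJs, one_div_one_div] at H2
  -- Step 3: Hölder with exponents `(A+s)/A`, `(A+s)/s` on `M₂ = ∫ h^{2(m+2)} g^{2s}`, giving `M₂ ≤ K`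
  set θ₃ : ℝ := A / (A + s) with hθ₃
  have hθ₃0 : 0 < θ₃ := by rw [hθ₃]; positivity
  have hθ₃1 : 0 < 1 - θ₃ := by
    rw [hθ₃, sub_div' (by positivity), div_pos_iff]; left; constructor <;> nlinarith
  have h1θ₃ : 1 - θ₃ = (s : ℝ) / (A + s) := by rw [hθ₃]; field_simp; ring
  have hpq₃ := Real.holderConjugate_one_div hθ₃0 hθ₃1 (by ring)
  set F₃ : (Fin n → ℝ) → ℝ := fun α => h α ^ ((2 * (A + s)) * θ₃) with hF₃
  set G₃ : (Fin n → ℝ) → ℝ := fun α => g α ^ ((2 * (A + s)) * (1 - θ₃)) with hG₃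
  have hF₃0 : ∀ α, 0 ≤ F₃ α := fun α => Real.rpow_nonneg (hh0 α) _
  have hG₃0 : ∀ α, 0 ≤ G₃ α := fun α => Real.rpow_nonneg (hg0 α) _
  have hF₃c : Continuous F₃ := hhc.rpow_const fun _ => Or.inr (by positivity)
  have hG₃c : Continuous G₃ := hgc.rpow_const fun _ => Or.inr (by positivity)
  have H3 := holder_box hF₃c hG₃c hF₃0 hG₃0 hpq₃
  have e3_prod : ∀ α, F₃ α * G₃ α = h α ^ (2 * (m + 2)) * g α ^ (2 * s) := by
    intro α; rw [hF₃, hG₃]; simp only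
    rw [show 2 * (A + s) * θ₃ = ((2 * (m + 2) : ℕ) : ℝ) by rw [hθ₃, hA]; push_cast; field_simp; try ring,
      Real.rpow_natCast, h1θ₃, show 2 * (A + s) * ((s : ℝ) / (A + s)) = ((2 * s : ℕ) : ℝ) by
        push_cast; field_simp, Real.rpow_natCast]
  have e3_F : ∀ α, F₃ α ^ (1 / θ₃) = h α ^ (2 * (m + 2 + s)) := by
    intro α; rw [hF₃]; simp only
    rw [← Real.rpow_mul (hh0 α), show 2 * (A + s) * θ₃ * (1 / θ₃) = ((2 * (m + 2 + s) : ℕ) : ℝ) by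
      rw [hA]; push_cast; field_simp; try ring, Real.rpow_natCast]
  have e3_G : ∀ α, G₃ α ^ (1 / (1 - θ₃)) = g α ^ (2 * (m + 2 + s)) := by
    intro α; rw [hG₃]; simp only
    rw [← Real.rpow_mul (hg0 α), show 2 * (A + s) * (1 - θ₃) * (1 / (1 - θ₃)) = ((2 * (m + 2 + s) : ℕ) : ℝ) by
      rw [hA]; push_cast; field_simp; try ring, Real.rpow_natCast]
  simp_rw [e3_prod, e3_F, e3_G] at H3
  rw [iK2, iK, one_div_one_div, one_div_one_div,
    ← Real.rpow_add' hK0 (by rw [show θ₃ + (1 - θ₃) = 1 by ring]; norm_num),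
    show θ₃ + (1 - θ₃) = 1 by ring, Real.rpow_one] at H3
  -- assemble
  have hM₂0 : 0 ≤ ∫ α in box n, h α ^ (2 * (m + 2)) * g α ^ (2 * s) :=
    integral_nonneg fun α => mul_nonneg (pow_nonneg (hh0 α) _) (pow_nonneg (hg0 α) _)
  have hI₂0 : 0 ≤ ∫ α in box n, h α ^ (m + 2) * g α ^ (2 * s) :=
    integral_nonneg fun α => mul_nonneg (pow_nonneg (hh0 α) _) (pow_nonneg (hg0 α) _)
  -- `∫ h^{m+2} g^{2s} ≤ Js^{1/2} K^{1/2}`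
  have H2' : ∫ α in box n, h α ^ (m + 2) * g α ^ (2 * s) ≤ Js ^ (1 / 2 : ℝ) * K ^ (1 / 2 : ℝ) := by
    refine H2.trans ?_
    gcongr
  -- `N' ≤ K^θ₁ · (Js^{1/2} K^{1/2})^{1/A}`
  have hcard : ((((L ×ˢ R).filter (fun ii' => vL ii'.1 = vR ii'.2)).card : ℕ) : ℝ)
      ≤ K ^ θ₁ * (Js ^ (1 / 2 : ℝ) * K ^ (1 / 2 : ℝ)) ^ (1 / A) := by
    refine step0.trans (H1.trans ?_)
    gcongr
  -- exponent algebra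
  have efinal : K ^ θ₁ * (Js ^ (1 / 2 : ℝ) * K ^ (1 / 2 : ℝ)) ^ (1 / A)
      = K ^ (1 - 1 / (2 * A)) * Js ^ (1 / (2 * A)) := by
    rw [Real.mul_rpow (Real.rpow_nonneg hJs0 _) (Real.rpow_nonneg hK0 _), ← Real.rpow_mul hJs0,
      ← Real.rpow_mul hK0, mul_comm (Js ^ _), ← mul_assoc,
      ← Real.rpow_add' hK0 (by have := hθ₁0; positivity)]
    congr 1
    · congr 1; rw [hθ₁]; field_simp; ring
    · congr 1; field_simp
  rw [efinal] at hcard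
  convert hcard using 3

/-! ### Assembly: Ford's Lemma 3.2 for `d = 0` -/

/-- **Diagonal lower bound**: `|I|^a · J_{b,n}(I) ≤ J_{a+b,n}(I)` (take `u = u'`).
[cite: Ford2002, proof of Lemma 3.2 ("counting the solutions of (3.1) with `z_i = w_i`")] -/
theorem card_pow_mul_J_le (n a b : ℕ) (I : Finset ℤ) : I.card ^ a * J n b I ≤ J n (a + b) I := by
  classical
  rw [J_add_eq_card]
  unfold J Jc
  rw [← card_tuples a I, ← card_product]
  refine card_le_card_of_injOn (fun q => ((q.1, q.2.1), (q.1, q.2.2))) ?_ ?_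
  · intro q hq
    rw [mem_coe, mem_product, mem_filter, mem_product] at hq
    rw [mem_coe, mem_filter, mem_product, mem_product, mem_product]
    refine ⟨⟨⟨hq.1, hq.2.1.1⟩, hq.1, hq.2.1.2⟩, ?_⟩
    simp only [hq.2.2, add_zero]
  · intro q _ q' _ h
    simp only [Prod.mk.injEq] at h
    exact Prod.ext h.1.1 (Prod.ext h.1.2 h.2.2)

/-- **Ford's Lemma 3.2 for `d = 0` (the `k³`-primes fundamental lemma), counting form.** Let
`n ≥ 2`, `s ≥ 1`, `P ≥ 16 n⁴`, and let `𝒫` be a nonempty finite set of primes with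
`P^{n(n-1)} ≤ ∏ 𝒫`. Then
`J_{n+s,n}([1,P]) ≤ 2 ∑_{p ∈ 𝒫} J₁'(p)` (`VMV.firstClassProd n s p (P₁ p)`, any `P₁` with
`P ≤ p P₁(p)`): the solutions with a coincidence inside an `n`-block are at most
`2n(n-1) K^{1-1/2n} J_s^{1/2n} < K/2` by Hölder and `K ≥ P^n J_s`, and the others are digit-injective
modulo some `p ∈ 𝒫` (Vandermonde pigeonhole).
[cite: Ford2002, Lemma 3.2 (case `d = 0`, `T = q = 1`, `Ψ_j = z^j`), proof (3.3)] -/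
theorem ford_lemma32_d0_count {m s P : ℕ} (hs : 1 ≤ s) (hP : 16 * (m + 2) ^ 4 ≤ P)
    {Ps : Finset ℕ} (hPs : ∀ p ∈ Ps, p.Prime) (hne : Ps.Nonempty)
    (hprod : P ^ ((m + 2) * (m + 2 - 1)) ≤ ∏ p ∈ Ps, p) {P₁ : ℕ → ℕ} (hP₁ : ∀ p ∈ Ps, P ≤ p * P₁ p) :
    (J (m + 2) (m + 2 + s) (Finset.Icc (1 : ℤ) P) : ℝ)
      ≤ 2 * ∑ p ∈ Ps, (firstClassProd (m + 2) s p (P₁ p) : ℝ) := by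
  classical
  set n := m + 2 with hn
  set I := Finset.Icc (1 : ℤ) P with hI
  have hcardI : I.card = P := by rw [hI, Int.card_Icc]; simp
  -- the solution set in product coordinates and its classes
  set S := ((tuples n I ×ˢ tuples s I) ×ˢ (tuples n I ×ˢ tuples s I)).filter
      (fun w => psv n w.1.1 + psv n w.1.2 = psv n w.2.1 + psv n w.2.2) with hS
  have hK : J n (n + s) I = S.card := by rw [hS, J_add_eq_card]
  set A := ((tuples n I ×ˢ tuples s I) ×ˢ (tuples n I ×ˢ tuples s I)).filter
      (fun w => psv n w.1.1 + psv n w.1.2 = psv n w.2.1 + psv n w.2.2 ∧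
        Function.Injective w.1.1 ∧ Function.Injective w.2.1) with hA
  set BX := S.filter (fun w => ¬ Function.Injective w.1.1) with hBX
  set BY := S.filter (fun w => ¬ Function.Injective w.2.1) with hBY
  have hsplit : S.card ≤ A.card + BX.card + BY.card := by
    have hsub : S ⊆ A ∪ BX ∪ BY := by
      intro w hw
      rw [mem_union, mem_union]
      by_cases h1 : Function.Injective w.1.1
      · by_cases h2 : Function.Injective w.2.1
        · left; left; rw [hA, mem_filter]; exact ⟨(mem_filter.1 hw).1, (mem_filter.1 hw).2, h1, h2⟩
        · right; rw [hBY, mem_filter]; exact ⟨hw, h2⟩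
      · left; right; rw [hBX, mem_filter]; exact ⟨hw, h1⟩
    exact (card_le_card hsub).trans ((card_union_le _ _).trans (by gcongr; exact card_union_le _ _))
  -- symmetry: `#BY = #BX`
  have hsymm : BY.card = BX.card := by
    refine card_nbij' (fun w => (w.2, w.1)) (fun w => (w.2, w.1)) ?_ ?_ (fun _ _ => rfl) (fun _ _ => rfl)
    · intro w hw
      rw [mem_coe, hBY, mem_filter, hS, mem_filter, mem_product] at hw
      rw [mem_coe, hBX, mem_filter, hS, mem_filter, mem_product]
      exact ⟨⟨⟨hw.1.1.2, hw.1.1.1⟩, hw.1.2.symm⟩, hw.2⟩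
    · intro w hw
      rw [mem_coe, hBX, mem_filter, hS, mem_filter, mem_product] at hw
      rw [mem_coe, hBY, mem_filter, hS, mem_filter, mem_product]
      exact ⟨⟨⟨hw.1.1.2, hw.1.1.1⟩, hw.1.2.symm⟩, hw.2⟩
  -- the coincidence classes and their Hölder bound
  set Bnd : ℝ := (J n (n + s) I : ℝ) ^ (1 - 1 / (2 * ((m : ℝ) + 2))) * (J n s I : ℝ) ^ (1 / (2 * ((m : ℝ) + 2)))
    with hBnd
  have hBnd0 : 0 ≤ Bnd := mul_nonneg (Real.rpow_nonneg (Nat.cast_nonneg _) _) (Real.rpow_nonneg (Nat.cast_nonneg _) _)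
  have hpair : ∀ (j : Fin (m + 2)) (i' : Fin (m + 1)),
      ((S.filter (fun w => w.1.1 j = w.1.1 (j.succAbove i'))).card : ℝ) ≤ Bnd := by
    intro j i'
    have h1 := card_coincidence_eq (n := n) (s := s) I j i'
    have h2 := card_doubled_le (n := n) (m := m) hs I
    rw [hS, filter_filter]
    rw [← h1] at h2
    exact h2
  have hBX : (BX.card : ℝ) ≤ (m + 2) * (m + 1) * Bnd := by
    have hcover : BX ⊆ (Finset.univ ×ˢ Finset.univ).biUnion
        (fun ji : Fin (m + 2) × Fin (m + 1) => S.filter (fun w => w.1.1 ji.1 = w.1.1 (ji.1.succAbove ji.2))) := by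
      intro w hw
      rw [hBX, mem_filter] at hw
      obtain ⟨a, b, hab, hne'⟩ := Function.not_injective_iff.1 hw.2
      obtain ⟨i', hi'⟩ := Fin.exists_succAbove_eq hne'.symm
      rw [mem_biUnion]
      exact ⟨(a, i'), mem_product.2 ⟨mem_univ _, mem_univ _⟩, mem_filter.2 ⟨hw.1, by rw [hi']; exact hab⟩⟩
    calc (BX.card : ℝ) ≤ (((Finset.univ ×ˢ Finset.univ).biUnion (fun ji : Fin (m + 2) × Fin (m + 1) =>
          S.filter (fun w => w.1.1 ji.1 = w.1.1 (ji.1.succAbove ji.2)))).card : ℝ) := by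
          exact_mod_cast card_le_card hcover
      _ ≤ ∑ ji ∈ (Finset.univ : Finset (Fin (m + 2))) ×ˢ (Finset.univ : Finset (Fin (m + 1))),
            ((S.filter (fun w => w.1.1 ji.1 = w.1.1 (ji.1.succAbove ji.2))).card : ℝ) := by
          exact_mod_cast card_biUnion_le
      _ ≤ ∑ _ji ∈ (Finset.univ : Finset (Fin (m + 2))) ×ˢ (Finset.univ : Finset (Fin (m + 1))), Bnd :=
          sum_le_sum fun ji _ => hpair ji.1 ji.2
      _ = (m + 2) * (m + 1) * Bnd := by
          rw [sum_const, card_product, card_univ, card_univ, Fintype.card_fin, Fintype.card_fin, nsmul_eq_mul]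
          push_cast; ring
  -- the diagonal lower bound `P^n J_s ≤ K`
  have hdiag : (P : ℝ) ^ n * (J n s I : ℝ) ≤ (J n (n + s) I : ℝ) := by
    have := card_pow_mul_J_le n n s I
    rw [hcardI] at this
    exact_mod_cast this
  -- sizes
  set K : ℝ := (J n (n + s) I : ℝ) with hKdef
  set Js : ℝ := (J n s I : ℝ) with hJsdef
  have hP16 : (16 : ℝ) * (n : ℝ) ^ 4 ≤ P := by rw [hn]; exact_mod_cast hP
  have hn2 : (2 : ℝ) ≤ n := by rw [hn]; push_cast; linarith
  have hP1 : (1 : ℝ) ≤ P := by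
    have : (1 : ℝ) ≤ (n : ℝ) ^ 4 := one_le_pow₀ (by linarith)
    linarith
  have hJs1 : 1 ≤ Js := by
    have h1 := card_pow_le_J n s I
    rw [hcardI] at h1
    have : (1 : ℝ) ≤ (P : ℝ) ^ s := one_le_pow₀ hP1
    calc (1 : ℝ) ≤ (P : ℝ) ^ s := this
      _ ≤ Js := by rw [hJsdef]; exact_mod_cast h1
  have hK1 : 1 ≤ K := le_trans (by nlinarith [one_le_pow₀ (n := n) hP1]) hdiag
  have hK0 : 0 < K := by linarith
  -- `K ≤ 2 #A`: otherwise `K < (16 n⁴)^n J_s ≤ P^n J_s ≤ K`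
  have hmain : K ≤ 2 * (A.card : ℝ) := by
    by_contra hlt
    push Not at hlt
    have h1 : K ≤ (A.card : ℝ) + 2 * ((m + 2) * (m + 1) * Bnd) := by
      have := hsplit
      rw [hsymm] at this
      calc K = (S.card : ℝ) := by rw [hKdef, hK]
        _ ≤ (A.card : ℝ) + (BX.card : ℝ) + (BX.card : ℝ) := by exact_mod_cast this
        _ ≤ (A.card : ℝ) + 2 * ((m + 2) * (m + 1) * Bnd) := by linarith
    -- hence `K/2 < 2 n² Bnd`
    have h2 : K < 4 * (n : ℝ) ^ 2 * Bnd := by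
      have : ((m : ℝ) + 2) * (m + 1) ≤ (n : ℝ) ^ 2 := by rw [hn]; push_cast; nlinarith
      nlinarith
    -- `Bnd = K^{1 - 1/2n} Js^{1/2n}`; divide by `K^{1-1/2n}`
    have hN : (2 : ℝ) * ((m : ℝ) + 2) = 2 * n := by rw [hn]; push_cast; ring
    have hexp : 0 < 1 / (2 * (n : ℝ)) := by positivity
    have hBnd' : Bnd = K ^ (1 - 1 / (2 * (n : ℝ))) * Js ^ (1 / (2 * (n : ℝ))) := by
      rw [hBnd, hN]
    have h3 : K ^ (1 / (2 * (n : ℝ))) < 4 * (n : ℝ) ^ 2 * Js ^ (1 / (2 * (n : ℝ))) := by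
      have hsplitK : K = K ^ (1 - 1 / (2 * (n : ℝ))) * K ^ (1 / (2 * (n : ℝ))) := by
        rw [← Real.rpow_add hK0, show 1 - 1 / (2 * (n : ℝ)) + 1 / (2 * (n : ℝ)) = 1 by ring, Real.rpow_one]
      have hKp : 0 < K ^ (1 - 1 / (2 * (n : ℝ))) := Real.rpow_pos_of_pos hK0 _
      have h2' : K ^ (1 - 1 / (2 * (n : ℝ))) * K ^ (1 / (2 * (n : ℝ)))
          < K ^ (1 - 1 / (2 * (n : ℝ))) * (4 * (n : ℝ) ^ 2 * Js ^ (1 / (2 * (n : ℝ)))) := by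
        rw [← hsplitK]
        calc K < 4 * (n : ℝ) ^ 2 * Bnd := h2
          _ = _ := by rw [hBnd']; ring
      exact lt_of_mul_lt_mul_left h2' hKp.le
    -- raise to the power `2n`
    have h4 : K < (4 * (n : ℝ) ^ 2) ^ (2 * n) * Js := by
      have hl0 : 0 ≤ K ^ (1 / (2 * (n : ℝ))) := Real.rpow_nonneg hK0.le _
      have h5 := pow_lt_pow_left₀ h3 hl0 (show 2 * n ≠ 0 by omega)
      rw [← Real.rpow_natCast, ← Real.rpow_mul hK0.le, mul_pow, ← Real.rpow_natCast (Js ^ _),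
        ← Real.rpow_mul (by linarith)] at h5
      rw [show 1 / (2 * (n : ℝ)) * ((2 * n : ℕ) : ℝ) = 1 by push_cast; field_simp, Real.rpow_one,
        Real.rpow_one] at h5
      exact h5
    -- compare with the diagonal
    have h6 : (4 * (n : ℝ) ^ 2) ^ (2 * n) ≤ (P : ℝ) ^ n := by
      rw [pow_mul, show (4 * (n : ℝ) ^ 2) ^ 2 = 16 * (n : ℝ) ^ 4 by ring]
      exact pow_le_pow_left₀ (by positivity) hP16 n
    have : K < K := calc
      K < (4 * (n : ℝ) ^ 2) ^ (2 * n) * Js := h4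
      _ ≤ (P : ℝ) ^ n * Js := by gcongr
      _ ≤ K := hdiag
    exact lt_irrefl _ this
  -- class A and the primes
  have hA' := card_classA_le_sum (n := n) (s := s) (P := P) hPs hne (by rw [hn]; exact hprod) hP₁
  calc K ≤ 2 * (A.card : ℝ) := hmain
    _ ≤ 2 * ∑ p ∈ Ps, (firstClassProd n s p (P₁ p) : ℝ) := by
        gcongr
        rw [hA, hI]
        exact_mod_cast hA'

/-- **Ford's Lemma 3.2 (`d = 0`) in the shape (6.10)**: under the hypotheses of
`ford_lemma32_d0_count`, if moreover every `p ∈ 𝒫` satisfies `n < p` and `P < pⁿ`, then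
`J_{n+s,n}([1,P]) ≤ 2 ∑_{p∈𝒫} p^{2s} (p(⌊P/p⌋+1))ⁿ n! p^{n(n-1)/2} J_{s,n}([1, ⌊P/p⌋+1])`.
[cite: Ford2002, Lemma 3.2 with (3.7) and (6.10) (`J_{s+k,k}(P) ≤ 4k³k! p^{2s+(k²-k)/2} P^k J_{s,k}(P/p)`)] -/
theorem ford_lemma32_d0 {m s P : ℕ} (hs : 1 ≤ s) (hP : 16 * (m + 2) ^ 4 ≤ P)
    {Ps : Finset ℕ} (hPs : ∀ p ∈ Ps, p.Prime ∧ m + 2 < p ∧ P < p ^ (m + 2)) (hne : Ps.Nonempty)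
    (hprod : P ^ ((m + 2) * (m + 2 - 1)) ≤ ∏ p ∈ Ps, p) :
    (J (m + 2) (m + 2 + s) (Finset.Icc (1 : ℤ) P) : ℝ)
      ≤ 2 * ∑ p ∈ Ps, (p : ℝ) ^ (2 * s) * ((p * (P / p + 1) : ℕ) : ℝ) ^ (m + 2)
          * ((Nat.factorial (m + 2) : ℝ) * (p : ℝ) ^ ((m + 2) * (m + 2 - 1) / 2))
          * (J (m + 2) s (Finset.Icc (1 : ℤ) (P / p + 1)) : ℝ) := by
  have h1 := ford_lemma32_d0_count (m := m) hs hP (fun p hp => (hPs p hp).1) hne hprod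
    (P₁ := fun p => P / p + 1) (fun p hp => by
      have := (Nat.lt_mul_div_succ P (hPs p hp).1.pos).le
      simpa [mul_comm] using this)
  refine h1.trans ?_
  gcongr with p hp
  obtain ⟨hpr, hnp, hPp⟩ := hPs p hp
  have hm1 : p * (P / p + 1) ≤ 1 * p ^ (m + 2) := by
    rw [one_mul, Nat.mul_add, mul_one]
    have h2 : P / p < p ^ (m + 1) := by
      rw [Nat.div_lt_iff_lt_mul hpr.pos, ← pow_succ]; exact hPp
    have h3 : p * (P / p) + p ≤ p * p ^ (m + 1) := by
      have := Nat.mul_le_mul_left p h2; simpa [Nat.mul_succ] using this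
    calc p * (P / p) + p ≤ p * p ^ (m + 1) := h3
      _ = p ^ (m + 2) := by rw [← pow_succ']
  have h4 := firstClassProd_le (n := m + 2) (s := s) (P₁ := P / p + 1) hpr hnp hs hm1
  rw [← J_Icc_eq_J_Yset] at h4
  simpa using h4

set_option maxHeartbeats 1600000 in
/-- **Ford's Lemma 6.5 (the `k³`-primes iteration step), in the tree's form and with the prime
windows as a hypothesis.** Let `n = m+2 ≥ 2`, `n(n+1)/2 ≤ 2s`, `0 ≤ Δ ≤ n²`, `1 ≤ η ≤ 2`, and let
`V ≥ n+1` with `16 n⁴ ≤ Vⁿ` and `4(2(s+n) − n(n+1)/2 + Δ) ≤ V^{n-1}`; suppose every window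
`(x, ηx]`, `x ≥ V`, contains `n³` primes. If `J_{s,n}([1,P]) ≤ C P^{2s-n(n+1)/2+Δ}` for all `P ≥ 1`,
then for all `P ≥ 1`
`J_{n+s,n}([1,P]) ≤ C · max(V^Δ, 4 n³ n! η^{n²-Δ}) · P^{2(s+n) - n(n+1)/2 + Δ(1-1/n)}`.
[cite: Ford2002, Lemma 6.5 (`C' = C max[4k³k! η^{k²-Δ}, V(ω)^Δ]`) via Lemma 3.2 (d = 0)] -/
theorem ford_lemma65 {m s : ℕ} {C Δ η V : ℝ} (hs2 : ((m : ℝ) + 2) * ((m : ℝ) + 3) / 2 ≤ 2 * s)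
    (hC0 : 0 ≤ C) (hΔ0 : 0 ≤ Δ) (hΔ : Δ ≤ ((m : ℝ) + 2) ^ 2) (hη1 : 1 ≤ η) (hη2 : η ≤ 2)
    (hVn : (m : ℝ) + 3 ≤ V) (hV16 : 16 * ((m : ℝ) + 2) ^ 4 ≤ V ^ (m + 2))
    (hV2 : 4 * ((2 * (s + (m + 2)) : ℝ) - (m + 2) * (m + 3) / 2 + Δ * (1 - 1 / (m + 2))) ≤ V ^ (m + 1))
    (hprime : ∀ x : ℝ, V ≤ x → ∃ Ps : Finset ℕ, Ps.card = (m + 2) ^ 3 ∧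
      ∀ p ∈ Ps, p.Prime ∧ x < p ∧ (p : ℝ) ≤ η * x)
    (hJ : ∀ P : ℕ, 1 ≤ P →
      (J (m + 2) s (Finset.Icc (1 : ℤ) P) : ℝ) ≤ C * (P : ℝ) ^ ((2 * s : ℝ) - (m + 2) * (m + 3) / 2 + Δ)) :
    ∀ P : ℕ, 1 ≤ P → (J (m + 2) (m + 2 + s) (Finset.Icc (1 : ℤ) P) : ℝ)
      ≤ C * max (V ^ Δ) (4 * ((m : ℝ) + 2) ^ 3 * (Nat.factorial (m + 2)) * η ^ (((m : ℝ) + 2) ^ 2 - Δ))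
          * (P : ℝ) ^ ((2 * (s + (m + 2)) : ℝ) - (m + 2) * (m + 3) / 2 + Δ * (1 - 1 / (m + 2))) := by
  -- abbreviations (`k = n = m + 2`)
  set k : ℕ := m + 2 with hk_def
  have hkR : (k : ℝ) = (m : ℝ) + 2 := by rw [hk_def]; push_cast; ring
  set e : ℝ := (2 * s : ℝ) - (m + 2) * (m + 3) / 2 + Δ with he_def
  set e' : ℝ := (2 * (s + (m + 2)) : ℝ) - (m + 2) * (m + 3) / 2 + Δ * (1 - 1 / (m + 2)) with he'_def
  set F : ℝ := 4 * ((m : ℝ) + 2) ^ 3 * (Nat.factorial (m + 2)) * η ^ (((m : ℝ) + 2) ^ 2 - Δ) with hF_def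
  set C' : ℝ := C * max (V ^ Δ) F with hC'_def
  have hk2 : 2 ≤ k := by omega
  have hk2R : (2 : ℝ) ≤ k := by exact_mod_cast hk2
  have hk0 : (0 : ℝ) < k := by linarith
  have hV3 : (3 : ℝ) ≤ V := le_trans (by have := (Nat.cast_nonneg m : (0:ℝ) ≤ m); linarith) hVn
  have hV0 : 0 < V := by linarith
  have hη0 : 0 < η := by linarith
  have hs1 : 1 ≤ s := by
    have h3 : (3 : ℝ) ≤ 2 * s := le_trans (by nlinarith [(Nat.cast_nonneg m : (0:ℝ) ≤ m)]) hs2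
    by_contra h
    push Not at h
    interval_cases s
    norm_num at h3
  have hΔk : Δ / k ≤ k := by rw [div_le_iff₀ hk0, hkR]; nlinarith
  have hΔk0 : 0 ≤ Δ / k := div_nonneg hΔ0 hk0.le
  have hee' : e' = e + 2 * k - Δ / k := by rw [he_def, he'_def, hkR]; field_simp; ring
  have heΔ : Δ ≤ e := by rw [he_def]; linarith
  have he0 : 0 ≤ e := hΔ0.trans heΔ
  have he'0 : 0 ≤ e' := by rw [hee']; nlinarith
  have hke : (k : ℝ) + e ≤ e' := by rw [hee']; linarith
  have hF0 : 0 ≤ F := by positivity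
  have hC'V : C * V ^ Δ ≤ C' := mul_le_mul_of_nonneg_left (le_max_left _ _) hC0
  have hC'F : C * F ≤ C' := mul_le_mul_of_nonneg_left (le_max_right _ _) hC0
  have hC'0 : 0 ≤ C' := le_trans (by positivity) hC'V
  intro P hP1
  have hP0 : (0 : ℝ) < P := by exact_mod_cast hP1
  by_cases hPV : (P : ℝ) < V ^ k
  · -- the trivial range `P < V^k`
    have h1 : (J k (k + s) (Finset.Icc (1 : ℤ) P) : ℝ)
        ≤ (P : ℝ) ^ (2 * k) * J k s (Finset.Icc (1 : ℤ) P) := by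
      have := J_add_le k k s (Finset.Icc (1 : ℤ) P)
      rw [Int.card_Icc] at this
      have hc : ((P : ℤ) + 1 - 1).toNat = P := by simp
      rw [hc] at this
      exact_mod_cast this
    have h2 := hJ P hP1
    have h4 : (P : ℝ) ^ (2 * k) * (P : ℝ) ^ e = (P : ℝ) ^ e' * (P : ℝ) ^ (Δ / k) := by
      rw [← Real.rpow_natCast, ← Real.rpow_add hP0, ← Real.rpow_add hP0]
      congr 1
      rw [hee']; push_cast; ring
    have h5 : (P : ℝ) ^ (Δ / k) ≤ V ^ Δ := by
      calc (P : ℝ) ^ (Δ / k) ≤ (V ^ k) ^ (Δ / k) := Real.rpow_le_rpow hP0.le hPV.le hΔk0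
        _ = V ^ Δ := by
            rw [← Real.rpow_natCast V k, ← Real.rpow_mul hV0.le]
            congr 1
            field_simp
    calc (J k (k + s) (Finset.Icc (1 : ℤ) P) : ℝ)
          ≤ (P : ℝ) ^ (2 * k) * (C * (P : ℝ) ^ e) := h1.trans (mul_le_mul_of_nonneg_left h2 (by positivity))
      _ = C * (P : ℝ) ^ (Δ / k) * (P : ℝ) ^ e' := by
          rw [show (P : ℝ) ^ (2 * k) * (C * (P : ℝ) ^ e) = C * ((P : ℝ) ^ (2 * k) * (P : ℝ) ^ e) by ring, h4]
          ring
      _ ≤ C * V ^ Δ * (P : ℝ) ^ e' := by gcongr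
      _ ≤ C' * (P : ℝ) ^ e' := by gcongr
  · -- the range `P ≥ V^k`
    push Not at hPV
    set x : ℝ := (P : ℝ) ^ ((k : ℝ)⁻¹) with hx_def
    have hx0 : 0 < x := Real.rpow_pos_of_pos hP0 _
    have hxk : x ^ k = (P : ℝ) := by rw [hx_def]; exact Real.rpow_inv_natCast_pow hP0.le (by omega)
    have hVx : V ≤ x := by
      have : (V ^ k) ^ ((k : ℝ)⁻¹) ≤ x := Real.rpow_le_rpow (by positivity) hPV (by positivity)
      rwa [Real.pow_rpow_inv_natCast hV0.le (by omega)] at this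
    have hx1 : 1 ≤ x := le_trans (by linarith) hVx
    obtain ⟨Ps, hcard, hPs⟩ := hprime x hVx
    -- facts about the primes
    have hPs' : ∀ p ∈ Ps, p.Prime ∧ m + 2 < p ∧ P < p ^ (m + 2) := by
      intro p hp
      obtain ⟨hpr, hxp, -⟩ := hPs p hp
      refine ⟨hpr, ?_, ?_⟩
      · have : ((m + 2 : ℕ) : ℝ) < p := by push_cast; linarith
        exact_mod_cast this
      · have : (P : ℝ) < (p : ℝ) ^ (m + 2) := by
          rw [← hxk]; exact pow_lt_pow_left₀ hxp hx0.le (by omega)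
        exact_mod_cast this
    have hne : Ps.Nonempty := by
      rw [← Finset.card_pos, hcard]; positivity
    have hprod : P ^ ((m + 2) * (m + 2 - 1)) ≤ ∏ p ∈ Ps, p := by
      have h1 : (x ^ (Ps.card) : ℝ) ≤ ∏ p ∈ Ps, (p : ℝ) := by
        rw [← Finset.prod_const]
        exact Finset.prod_le_prod (fun _ _ => hx0.le) (fun p hp => (hPs p hp).2.1.le)
      rw [hcard] at h1
      have hexp : k * ((m + 2) * (m + 2 - 1)) ≤ (m + 2) ^ 3 := by
        rw [hk_def, show m + 2 - 1 = m + 1 by omega]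
        calc (m + 2) * ((m + 2) * (m + 1)) ≤ (m + 2) * ((m + 2) * (m + 2)) :=
              Nat.mul_le_mul_left _ (Nat.mul_le_mul_left _ (by omega))
          _ = (m + 2) ^ 3 := by ring
      have h2 : (P : ℝ) ^ ((m + 2) * (m + 2 - 1)) ≤ x ^ ((m + 2) ^ 3) := by
        rw [← hxk, ← pow_mul]
        exact pow_le_pow_right₀ hx1 hexp
      have h3 : (P : ℝ) ^ ((m + 2) * (m + 2 - 1)) ≤ ∏ p ∈ Ps, (p : ℝ) := h2.trans h1
      have h4 : ((P ^ ((m + 2) * (m + 2 - 1)) : ℕ) : ℝ) ≤ ((∏ p ∈ Ps, p : ℕ) : ℝ) := by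
        rw [Nat.cast_pow, Nat.cast_prod]; exact h3
      exact_mod_cast h4
    have hP16 : 16 * (m + 2) ^ 4 ≤ P := by
      have h1 : ((16 * (m + 2) ^ 4 : ℕ) : ℝ) ≤ (P : ℝ) := by push_cast; exact hV16.trans hPV
      exact_mod_cast h1
    have h32 := ford_lemma32_d0 (m := m) hs1 hP16 hPs' hne hprod
    -- bound each term
    have hterm : ∀ p ∈ Ps, (p : ℝ) ^ (2 * s) * ((p * (P / p + 1) : ℕ) : ℝ) ^ (m + 2)
          * ((Nat.factorial (m + 2) : ℝ) * (p : ℝ) ^ ((m + 2) * (m + 2 - 1) / 2))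
          * (J (m + 2) s (Finset.Icc (1 : ℤ) (P / p + 1)) : ℝ)
        ≤ 2 * (Nat.factorial k : ℝ) * C * η ^ ((k : ℝ) ^ 2 - Δ) * (P : ℝ) ^ e' := by
      intro p hp
      obtain ⟨hpr, hxp, hpx⟩ := hPs p hp
      have hp0 : (0 : ℝ) < p := by exact_mod_cast hpr.pos
      set P₁ : ℕ := P / p + 1 with hP₁_def
      have hP₁1 : 1 ≤ P₁ := by rw [hP₁_def]; exact Nat.le_add_left 1 _
      have hJ2 := hJ P₁ hP₁1
      -- `r = p/P`, `(1+r)^{e'} ≤ 2`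
      set r : ℝ := (p : ℝ) / P with hr_def
      have hr0 : 0 ≤ r := by rw [hr_def]; positivity
      have hxk1 : V ^ (k - 1) ≤ x ^ (k - 1) := pow_le_pow_left₀ hV0.le hVx _
      have hrx : r ≤ 2 / x ^ (k - 1) := by
        have hq2x : (p : ℝ) ≤ 2 * x := hpx.trans (mul_le_mul_of_nonneg_right hη2 hx0.le)
        rw [hr_def, div_le_div_iff₀ hP0 (by positivity)]
        calc (p : ℝ) * x ^ (k - 1) ≤ 2 * x * x ^ (k - 1) := by gcongr
          _ = 2 * x ^ k := by rw [mul_assoc, ← pow_succ', Nat.sub_add_cancel (by omega : 1 ≤ k)]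
          _ = 2 * P := by rw [hxk]
      have her : e' * r ≤ 1 / 2 := by
        have h1 : e' * r ≤ e' * (2 / V ^ (k - 1)) := by
          apply mul_le_mul_of_nonneg_left _ he'0
          exact hrx.trans (div_le_div_of_nonneg_left (by norm_num) (by positivity) hxk1)
        have hVk1 : 0 < V ^ (k - 1) := by positivity
        have hV2' : 4 * e' ≤ V ^ (k - 1) := by rw [he'_def, hk_def]; exact hV2
        calc e' * r ≤ e' * (2 / V ^ (k - 1)) := h1
          _ = (4 * e') / V ^ (k - 1) / 2 := by ring
          _ ≤ V ^ (k - 1) / V ^ (k - 1) / 2 := by gcongr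
          _ = 1 / 2 := by rw [div_self hVk1.ne']
      have h1r1 : 1 ≤ 1 + r := le_add_of_nonneg_right hr0
      have h1r0 : 0 < 1 + r := add_pos_of_pos_of_nonneg one_pos hr0
      have exp_half_le_two : Real.exp (1 / 2) ≤ 2 := by
        have h : Real.exp (1 / 2) ^ 2 < 2 ^ 2 := by
          rw [← Real.exp_nat_mul]; norm_num; linarith [Real.exp_one_lt_d9]
        exact le_of_lt ((pow_lt_pow_iff_left₀ (Real.exp_pos _).le (by norm_num) two_ne_zero).1 h)
      have h1rke : (1 + r) ^ k * (1 + r) ^ e ≤ 2 := by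
        calc (1 + r) ^ k * (1 + r) ^ e = (1 + r) ^ ((k : ℝ) + e) := by
              rw [← Real.rpow_natCast, ← Real.rpow_add h1r0]
          _ ≤ (1 + r) ^ e' := Real.rpow_le_rpow_of_exponent_le h1r1 hke
          _ ≤ Real.exp (e' * r) := one_add_rpow_le_exp hr0 he'0
          _ ≤ Real.exp (1 / 2) := Real.exp_le_exp.2 her
          _ ≤ 2 := exp_half_le_two
      -- `P₁ ≤ (P/p)(1+r)`, `p P₁ ≤ P (1+r)`
      have hPq0 : 0 < (P : ℝ) / p := by positivity
      have hP₁le : (P₁ : ℝ) ≤ (P : ℝ) / p * (1 + r) := by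
        have h1 : ((P / p : ℕ) : ℝ) ≤ (P : ℝ) / p := Nat.cast_div_le
        have h2 : (P : ℝ) / p * (1 + r) = (P : ℝ) / p + 1 := by rw [hr_def]; field_simp
        rw [h2, hP₁_def]; push_cast
        exact add_le_add h1 le_rfl
      have hP₁0 : (0 : ℝ) ≤ P₁ := by positivity
      have hpP₁le : ((p * (P / p + 1) : ℕ) : ℝ) ≤ (P : ℝ) * (1 + r) := by
        have : (P : ℝ) * (1 + r) = p * ((P : ℝ) / p * (1 + r)) := by rw [hr_def]; field_simp
        rw [this, ← hP₁_def]; push_cast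
        exact mul_le_mul_of_nonneg_left hP₁le hp0.le
      -- the `p`-powers: `p^{2s} p^{k(k-1)/2} / p^e = p^{k²-Δ} ≤ η^{k²-Δ} P^{k-Δ/k}`
      have hkΔ0 : 0 ≤ (k : ℝ) ^ 2 - Δ := by rw [hkR]; linarith
      have q1 : (p : ℝ) ^ (2 * s) * (p : ℝ) ^ (k * (k - 1) / 2) / (p : ℝ) ^ e
          = (p : ℝ) ^ ((k : ℝ) ^ 2 - Δ) := by
        rw [← Real.rpow_natCast (p : ℝ) (2 * s), ← Real.rpow_natCast (p : ℝ) (k * (k - 1) / 2),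
          ← Real.rpow_add hp0, ← Real.rpow_sub hp0]
        congr 1
        rw [cast_mul_pred_div_two, he_def, hkR]; push_cast; ring
      have q2 : (p : ℝ) ^ ((k : ℝ) ^ 2 - Δ) ≤ η ^ ((k : ℝ) ^ 2 - Δ) * (P : ℝ) ^ ((k : ℝ) - Δ / k) := by
        calc (p : ℝ) ^ ((k : ℝ) ^ 2 - Δ) ≤ (η * x) ^ ((k : ℝ) ^ 2 - Δ) :=
              Real.rpow_le_rpow hp0.le hpx hkΔ0
          _ = η ^ ((k : ℝ) ^ 2 - Δ) * x ^ ((k : ℝ) ^ 2 - Δ) := Real.mul_rpow hη0.le hx0.le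
          _ = η ^ ((k : ℝ) ^ 2 - Δ) * (P : ℝ) ^ ((k : ℝ) - Δ / k) := by
              congr 1
              rw [hx_def, ← Real.rpow_mul hP0.le]
              congr 1
              field_simp
      have q3 : (p : ℝ) ^ (2 * s) * (p : ℝ) ^ (k * (k - 1) / 2) * (((P : ℝ) / p) ^ e)
          ≤ η ^ ((k : ℝ) ^ 2 - Δ) * (P : ℝ) ^ ((k : ℝ) - Δ / k) * (P : ℝ) ^ e := by
        have hpe0 : 0 < (p : ℝ) ^ e := Real.rpow_pos_of_pos hp0 _
        rw [Real.div_rpow hP0.le hp0.le, show (p : ℝ) ^ (2 * s) * (p : ℝ) ^ (k * (k - 1) / 2)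
          * ((P : ℝ) ^ e / (p : ℝ) ^ e) = ((p : ℝ) ^ (2 * s) * (p : ℝ) ^ (k * (k - 1) / 2) / (p : ℝ) ^ e)
          * (P : ℝ) ^ e by field_simp, q1]
        exact mul_le_mul_of_nonneg_right q2 (by positivity)
      have q4 : (P : ℝ) ^ k * ((P : ℝ) ^ ((k : ℝ) - Δ / k) * (P : ℝ) ^ e) = (P : ℝ) ^ e' := by
        rw [← Real.rpow_natCast, ← Real.rpow_add hP0, ← Real.rpow_add hP0]
        congr 1
        rw [hee']; ring
      have i1 : ((p * (P / p + 1) : ℕ) : ℝ) ^ k ≤ (P : ℝ) ^ k * (1 + r) ^ k := by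
        rw [← mul_pow]; exact pow_le_pow_left₀ (by positivity) hpP₁le k
      have i2 : (J k s (Finset.Icc (1 : ℤ) P₁) : ℝ) ≤ C * ((((P : ℝ) / p) ^ e) * (1 + r) ^ e) := by
        refine hJ2.trans (mul_le_mul_of_nonneg_left ?_ hC0)
        calc (P₁ : ℝ) ^ e ≤ ((P : ℝ) / p * (1 + r)) ^ e := Real.rpow_le_rpow hP₁0 hP₁le he0
          _ = ((P : ℝ) / p) ^ e * (1 + r) ^ e := Real.mul_rpow hPq0.le h1r0.le
      have hPpe0 : 0 ≤ ((P : ℝ) / p) ^ e := (Real.rpow_pos_of_pos hPq0 _).le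
      have hkk : (m + 2) * (m + 2 - 1) / 2 = k * (k - 1) / 2 := by rw [hk_def]
      rw [hkk]
      calc (p : ℝ) ^ (2 * s) * ((p * (P / p + 1) : ℕ) : ℝ) ^ k
            * ((Nat.factorial k : ℝ) * (p : ℝ) ^ (k * (k - 1) / 2))
            * (J k s (Finset.Icc (1 : ℤ) P₁) : ℝ)
          ≤ (p : ℝ) ^ (2 * s) * ((P : ℝ) ^ k * (1 + r) ^ k)
            * ((Nat.factorial k : ℝ) * (p : ℝ) ^ (k * (k - 1) / 2))
            * (C * ((((P : ℝ) / p) ^ e) * (1 + r) ^ e)) := by gcongr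
        _ = ((Nat.factorial k : ℝ) * C)
            * ((p : ℝ) ^ (2 * s) * (p : ℝ) ^ (k * (k - 1) / 2) * (((P : ℝ) / p) ^ e))
            * (P : ℝ) ^ k * ((1 + r) ^ k * (1 + r) ^ e) := by ring
        _ ≤ ((Nat.factorial k : ℝ) * C)
            * (η ^ ((k : ℝ) ^ 2 - Δ) * (P : ℝ) ^ ((k : ℝ) - Δ / k) * (P : ℝ) ^ e)
            * (P : ℝ) ^ k * 2 := by gcongr
        _ = 2 * (Nat.factorial k : ℝ) * C * η ^ ((k : ℝ) ^ 2 - Δ)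
            * ((P : ℝ) ^ k * ((P : ℝ) ^ ((k : ℝ) - Δ / k) * (P : ℝ) ^ e)) := by ring
        _ = 2 * (Nat.factorial k : ℝ) * C * η ^ ((k : ℝ) ^ 2 - Δ) * (P : ℝ) ^ e' := by rw [q4]
    -- sum over the `k³` primes
    have hPe'0 : 0 ≤ (P : ℝ) ^ e' := (Real.rpow_pos_of_pos hP0 _).le
    calc (J k (k + s) (Finset.Icc (1 : ℤ) P) : ℝ) ≤ _ := h32
      _ ≤ 2 * ∑ _p ∈ Ps, 2 * (Nat.factorial k : ℝ) * C * η ^ ((k : ℝ) ^ 2 - Δ) * (P : ℝ) ^ e' :=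
          mul_le_mul_of_nonneg_left (Finset.sum_le_sum hterm) (by norm_num)
      _ = C * (4 * (k : ℝ) ^ 3 * (Nat.factorial k) * η ^ ((k : ℝ) ^ 2 - Δ)) * (P : ℝ) ^ e' := by
          rw [Finset.sum_const, hcard, nsmul_eq_mul]; push_cast; ring
      _ = C * F * (P : ℝ) ^ e' := by rw [hF_def, hkR]
      _ ≤ C' * (P : ℝ) ^ e' := by gcongr

end FordVK
end Literature.NumberTheory.LFunctions
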